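import Summits.CriticalPhenomena.PercolationContinuityZ3.Theorems.PercNearOneGluingNoHeavyLowerTailSahiHubCornerChain
import Mathlib.Tactic.Linarith
import Mathlib.Tactic.Positivity
import Mathlib.Tactic.FinCases
import HarnessLib

/-!
# `NoHeavyLowerTail` (crux stmt-CriticalPhenomena-4575), P2 — T₁ WITH TWO CO-SHARED COINS ⟸ ONE BOX INEQUALITY (the square block)

Seat `prim-masterthm-p2`, gen 31 (memo `FROM-prim-masterthm-p2-g31-PAIR-DECOMPOSITION.md` §2, SAHI-ROUTE.md §4.58; `--supports stmt-CriticalPhenomena-4575`).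
No `sorry`, no named facts, standard axioms.

Co-shared block = the square `γ = Fin 2 × Fin 2` (two coins) with a PRODUCT weight `sqW u v (i,j) = u i · v j`.  By the pair decomposition
(`…SahiHubCornerChain`) `2q₁ = Σ_{x,y} w(x)w(y)·CF(x,y)`; of the 16 ordered pairs, 14 are comparable in the product order (pair form `≥ 0` by
`pairForm_nonneg_of_le`) and the two orderings of the incomparable antipodal pair `{(0,1),(1,0)}` carry the same weight `u₀u₁v₀v₁` as the long diagonal
`{(0,0),(1,1)}`.  Hence (`cornerQ1_nonneg_square_of_box`, `cornerQ0_nonneg_square_of_box`, `sahiE_three_nonneg_T1_square_of_box`):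
**Q, and Kahn's `C₃` for `f(z,c,a), g(z,c,b), h(z,a,b)` with TWO co-shared coins `c = (c₁,c₂)` (any biases), follow from the single BOX INEQUALITY
`CF((0,0),(1,1)) + CF((0,1),(1,0)) ≥ 0`** for the given sections (`hbox`) — the dimension-2 case of conjecture FCQ (= gen-29's crossed-positivity atom "(3,1)"),
census-clean (kit j245242: 0 negatives in 8.7·10⁸ exhaustive + adversarial cells of this shape), OPEN.  Dimension 0 and 1 of FCQ are the (1,1) atom and
`crossForm_nonneg`; this file isolates exactly what dimension 2 must supply.
HONEST LABEL: conditional reduction (typed hypothesis `hbox`, no new theorem about `hbox` itself); T₁ with ≥ 2 co-shared coins and Kahn's `C₃` OPEN. [this work]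
-/

noncomputable section

open scoped Classical

namespace Summit.CriticalPhenomena.PercolationContinuityZ3.Theorems

namespace SahiHubCornerChain

open Finset Literature.Combinatorics.Sahi2008 SahiHubCorner SahiHubTwoLevel

/-- Product weight on the square block `Fin 2 × Fin 2`: `w(i,j) = u i · v j`. [this work] -/
def sqW (u v : Fin 2 → ℝ) : Fin 2 × Fin 2 → ℝ := fun x => u x.1 * v x.2

variable {α β : Type} [Fintype α] [Fintype β]
  {wA : α → ℝ} {wB : β → ℝ} {u v : Fin 2 → ℝ}
  {f : Fin 2 → (Fin 2 × Fin 2) → α → ℝ} {g : Fin 2 → (Fin 2 × Fin 2) → β → ℝ} {h : Fin 2 → α → β → ℝ}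

omit [Fintype α] [Fintype β] in
/-- The product weight is nonnegative for nonnegative coin weights. [this work] -/
theorem sqW_nonneg (hu : ∀ i, 0 ≤ u i) (hv : ∀ j, 0 ≤ v j) (x : Fin 2 × Fin 2) : 0 ≤ sqW u v x :=
  mul_nonneg (hu x.1) (hv x.2)

omit [Fintype α] [Fintype β] in
/-- The product weight has mass one when both coins do. [this work] -/
theorem sum_sqW (hu1 : u 0 + u 1 = 1) (hv1 : v 0 + v 1 = 1) : ∑ x, sqW u v x = 1 := by
  simp only [Fintype.sum_prod_type, Fin.sum_univ_two, sqW]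
  nlinarith [hu1, hv1]

/-- **Q ON THE SQUARE BLOCK ⟸ THE BOX INEQUALITY, corner `t = 1`.**  For sections monotone along the square (product order) and in the hub level,
nonnegative, `α, β` FKG: if `CF((0,0),(1,1)) + CF((0,1),(1,0)) ≥ 0` then `q₁ ≥ 0` at every pair of coin biases. [this work] -/
theorem cornerQ1_nonneg_square_of_box [DistribLattice α] [DistribLattice β]
    (hA : IsFKGMeasure wA) (hB : IsFKGMeasure wB)
    (hu : ∀ i, 0 ≤ u i) (hv : ∀ j, 0 ≤ v j) (hu1 : u 0 + u 1 = 1) (hv1 : v 0 + v 1 = 1)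
    (hf0 : ∀ z c a, 0 ≤ f z c a) (hfa : ∀ z c, Monotone (f z c)) (hfc : ∀ z a, Monotone (fun c => f z c a))
    (hfz : ∀ c a, f 0 c a ≤ f 1 c a)
    (hg0 : ∀ z c b, 0 ≤ g z c b) (hgb : ∀ z c, Monotone (g z c)) (hgc : ∀ z b, Monotone (fun c => g z c b))
    (hgz : ∀ c b, g 0 c b ≤ g 1 c b)
    (hh0 : ∀ z a b, 0 ≤ h z a b) (hha : ∀ z b, Monotone (fun a => h z a b)) (hhb : ∀ z a, Monotone (h z a))
    (hhz : ∀ a b, h 0 a b ≤ h 1 a b)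
    (hbox : 0 ≤ pairForm wA wB f g h (0, 0) (1, 1) + pairForm wA wB f g h (0, 1) (1, 0)) :
    0 ≤ cornerQ1 wA wB (sqW u v) f g h := by
  have h2 := two_mul_cornerQ1_eq_sum_pairForm (wC := sqW u v) (f := f) (g := g) (h := h)
    hA.sum_eq_one hB.sum_eq_one (sum_sqW hu1 hv1)
  -- comparable pairs are nonnegative
  have P : ∀ x y : Fin 2 × Fin 2, x ≤ y → 0 ≤ pairForm wA wB f g h x y := fun x y hxy =>
    pairForm_nonneg_of_le hA hB hxy hf0 hfa hfc hfz hg0 hgb hgc hgz hh0 hha hhb hhz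
  have S : ∀ x y : Fin 2 × Fin 2, pairForm wA wB f g h y x = pairForm wA wB f g h x y := fun x y => pairForm_symm y x
  -- the sixteen ordered pairs
  have e00 := P (0, 0) (0, 0) le_rfl
  have e01 := P (0, 1) (0, 1) le_rfl
  have e10 := P (1, 0) (1, 0) le_rfl
  have e11 := P (1, 1) (1, 1) le_rfl
  have d01 : (0 : Fin 2) ≤ 1 := by decide
  have c1 := P (0, 0) (0, 1) (Prod.mk_le_mk.2 ⟨le_rfl, d01⟩)
  have c2 := P (0, 0) (1, 0) (Prod.mk_le_mk.2 ⟨d01, le_rfl⟩)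
  have c3 := P (0, 0) (1, 1) (Prod.mk_le_mk.2 ⟨d01, d01⟩)
  have c4 := P (0, 1) (1, 1) (Prod.mk_le_mk.2 ⟨d01, le_rfl⟩)
  have c5 := P (1, 0) (1, 1) (Prod.mk_le_mk.2 ⟨le_rfl, d01⟩)
  have s1 := S (0, 0) (0, 1); have s2 := S (0, 0) (1, 0); have s3 := S (0, 0) (1, 1)
  have s4 := S (0, 1) (1, 1); have s5 := S (1, 0) (1, 1); have s6 := S (0, 1) (1, 0)
  have w00 := sqW_nonneg hu hv (0, 0); have w01 := sqW_nonneg hu hv (0, 1)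
  have w10 := sqW_nonneg hu hv (1, 0); have w11 := sqW_nonneg hu hv (1, 1)
  -- the box weight identity: w(0,1)·w(1,0) = w(0,0)·w(1,1) for a product weight (both orders)
  have wbox : sqW u v (0, 1) * sqW u v (1, 0) = sqW u v (0, 0) * sqW u v (1, 1) := by simp only [sqW]; ring
  have wbox' : sqW u v (1, 0) * sqW u v (0, 1) = sqW u v (0, 0) * sqW u v (1, 1) := by simp only [sqW]; ring
  have hb : 0 ≤ sqW u v (0, 0) * sqW u v (1, 1) * (pairForm wA wB f g h (0, 0) (1, 1) + pairForm wA wB f g h (0, 1) (1, 0)) :=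
    mul_nonneg (mul_nonneg w00 w11) hbox
  rw [Fintype.sum_prod_type] at h2
  simp only [Fintype.sum_prod_type, Fin.sum_univ_two] at h2
  rw [s1, s2, s3, s4, s5, s6, wbox, wbox'] at h2
  have t1 := mul_nonneg (mul_nonneg w00 w00) e00
  have t2 := mul_nonneg (mul_nonneg w01 w01) e01
  have t3 := mul_nonneg (mul_nonneg w10 w10) e10
  have t4 := mul_nonneg (mul_nonneg w11 w11) e11
  have t5 := mul_nonneg (mul_nonneg w00 w01) c1
  have t5' := mul_nonneg (mul_nonneg w01 w00) c1
  have t6 := mul_nonneg (mul_nonneg w00 w10) c2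
  have t6' := mul_nonneg (mul_nonneg w10 w00) c2
  have t7 := mul_nonneg (mul_nonneg w01 w11) c4
  have t7' := mul_nonneg (mul_nonneg w11 w01) c4
  have t8 := mul_nonneg (mul_nonneg w10 w11) c5
  have t8' := mul_nonneg (mul_nonneg w11 w10) c5
  linarith [t1, t2, t3, t4, t5, t5', t6, t6', t7, t7', t8, t8', hb, h2]

/-- **Q ON THE SQUARE BLOCK ⟸ THE BOX INEQUALITY, corner `t = 0`** (`q₀ = q₁ + Δf·Δg·Δh ≥ q₁`). [this work] -/
theorem cornerQ0_nonneg_square_of_box [DistribLattice α] [DistribLattice β]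
    (hA : IsFKGMeasure wA) (hB : IsFKGMeasure wB)
    (hu : ∀ i, 0 ≤ u i) (hv : ∀ j, 0 ≤ v j) (hu1 : u 0 + u 1 = 1) (hv1 : v 0 + v 1 = 1)
    (hf0 : ∀ z c a, 0 ≤ f z c a) (hfa : ∀ z c, Monotone (f z c)) (hfc : ∀ z a, Monotone (fun c => f z c a))
    (hfz : ∀ c a, f 0 c a ≤ f 1 c a)
    (hg0 : ∀ z c b, 0 ≤ g z c b) (hgb : ∀ z c, Monotone (g z c)) (hgc : ∀ z b, Monotone (fun c => g z c b))
    (hgz : ∀ c b, g 0 c b ≤ g 1 c b)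
    (hh0 : ∀ z a b, 0 ≤ h z a b) (hha : ∀ z b, Monotone (fun a => h z a b)) (hhb : ∀ z a, Monotone (h z a))
    (hhz : ∀ a b, h 0 a b ≤ h 1 a b)
    (hbox : 0 ≤ pairForm wA wB f g h (0, 0) (1, 1) + pairForm wA wB f g h (0, 1) (1, 0)) :
    0 ≤ cornerQ0 wA wB (sqW u v) f g h := by
  rw [cornerQ0_eq]
  have h1 := cornerQ1_nonneg_square_of_box hA hB hu hv hu1 hv1 hf0 hfa hfc hfz hg0 hgb hgc hgz hh0 hha hhb hhz hbox
  have hC0 : ∀ c, 0 ≤ sqW u v c := sqW_nonneg hu hv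
  have hF := exL_F1_sub_nonneg (f := f) (wC := sqW u v) hA.nonneg hB.sum_eq_one hC0 hfz
  have hG := exL_F2_sub_nonneg (g := g) (wC := sqW u v) hA.sum_eq_one hB.nonneg hC0 hgz
  have hH := exL_F3_sub_nonneg (h := h) (wC := sqW u v) hA.nonneg hB.nonneg (sum_sqW hu1 hv1) hhz
  have := mul_nonneg (mul_nonneg hF hG) hH
  linarith

/-- **T₁ WITH TWO CO-SHARED COINS ⟸ THE BOX INEQUALITY.**  Hub coin `z` (weight `wZ`), co-shared coins `c = (c₁,c₂) ∈ Fin 2 × Fin 2` with the product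
weight `sqW u v` (any biases), private FKG blocks `α, β`; `f(z,c,a), g(z,c,b), h(z,a,b)` nonnegative and monotone in every argument.  If the box
inequality `CF((0,0),(1,1)) + CF((0,1),(1,0)) ≥ 0` holds for these sections, then Sahi's `E₃(f,g,h) ≥ 0` (Kahn's `C₃`).  The box inequality is the
dimension-2 case of conjecture FCQ (memo §2), census-clean, OPEN. [this work] -/
theorem sahiE_three_nonneg_T1_square_of_box [DistribLattice α] [DistribLattice β] {wZ : Fin 2 → ℝ}
    (hA : IsFKGMeasure wA) (hB : IsFKGMeasure wB)
    (hu : ∀ i, 0 ≤ u i) (hv : ∀ j, 0 ≤ v j) (hu1 : u 0 + u 1 = 1) (hv1 : v 0 + v 1 = 1)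
    (hZ0 : 0 ≤ wZ 0) (hZ1 : 0 ≤ wZ 1) (hZ : wZ 0 + wZ 1 = 1)
    (hf0 : ∀ z c a, 0 ≤ f z c a) (hfa : ∀ z c, Monotone (f z c)) (hfc : ∀ z a, Monotone (fun c => f z c a))
    (hfz : ∀ c a, f 0 c a ≤ f 1 c a)
    (hg0 : ∀ z c b, 0 ≤ g z c b) (hgb : ∀ z c, Monotone (g z c)) (hgc : ∀ z b, Monotone (fun c => g z c b))
    (hgz : ∀ c b, g 0 c b ≤ g 1 c b)
    (hh0 : ∀ z a b, 0 ≤ h z a b) (hha : ∀ z b, Monotone (fun a => h z a b)) (hhb : ∀ z a, Monotone (h z a))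
    (hhz : ∀ a b, h 0 a b ≤ h 1 a b)
    (hbox : 0 ≤ pairForm wA wB f g h (0, 0) (1, 1) + pairForm wA wB f g h (0, 1) (1, 0)) :
    0 ≤ sahiE (W wA wB (sqW u v) wZ) 3 ![F1 f, F2 g, F3 h] := by
  have hC : IsFKGMeasure (sqW u v) :=
    { nonneg := sqW_nonneg hu hv
      sum_eq_one := sum_sqW hu1 hv1
      mul_le_mul := by
        intro a b
        simp only [sqW, Prod.fst_inf, Prod.snd_inf, Prod.fst_sup, Prod.snd_sup]
        rcases le_total a.1 b.1 with h1 | h1 <;> rcases le_total a.2 b.2 with h2 | h2 <;>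
          simp only [inf_eq_left.2 h1, sup_eq_right.2 h1, inf_eq_right.2 h1, sup_eq_left.2 h1,
            inf_eq_left.2 h2, sup_eq_right.2 h2, inf_eq_right.2 h2, sup_eq_left.2 h2] <;> nlinarith [hu a.1, hu b.1, hv a.2, hv b.2] }
  exact sahiE_three_nonneg_T1_of_corner hA hB hC hZ0 hZ1 hZ hf0 hfa hfc hg0 hgb hgc hh0 hha hhb
    (cornerQ0_nonneg_square_of_box hA hB hu hv hu1 hv1 hf0 hfa hfc hfz hg0 hgb hgc hgz hh0 hha hhb hhz hbox)
    (cornerQ1_nonneg_square_of_box hA hB hu hv hu1 hv1 hf0 hfa hfc hfz hg0 hgb hgc hgz hh0 hha hhb hhz hbox)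

end SahiHubCornerChain

end Summit.CriticalPhenomena.PercolationContinuityZ3.Theorems
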